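import Mathlib
import Summits.Ventures.PercRepro2.RootEdgeTheorems
import Summits.Ventures.PercRepro2.RootEdgeForced

/-!
# The root edge, V: `RootCross` is FORCED by (3M) — the candidate of record reduces to the
unmerged 5-mark inequality `ThreeMark`
(blind cell PercRepro2, night-3 g22, 2026-08-28; `proofs/NIGHT3-CERT.md` §31)

At the root edge `g = {a₁, v}` let `P_t = p[g := t]`.  The cells `m_t(χ, ω, β)` of `P_t`
(`RootEdgeCells.lean`) pin to `t·m_1 + (1 − t)·m_0`, and under `P¹`:

* every cell with `v ∈ C₂` is null (`cell_update_one_true`: `g` open and `v ∈ C₂` put `a₁ ∈ C₂`);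
* `m_1(0, ω, 1) = m_0(0, ω, 1) + bvcell_0(ω)` and `m_1(0, ω, 0) = m_0(0, ω, 0) − bvcell_0(ω)`
  (`cell_update_one_false_true`, `cell_update_one_false_false`: opening `g` merges `C(v)` into
  `C(a₁)`, so `b ∈ C₁` becomes `b ∈ C₁ ∪ C(v)`), and the `b ~ v` cells of `P¹` are null
  (`bvcell_update_one`).

Hence the (3M)-slack of `P_t`, `m_t(101)m_t(010) + m_t(001)m_t(110) − m_t(011)m_t(100) −
m_t(111)m_t(000)`, is `(1 − t)·[(1 − t)·(3M)(P⁰) + t·RootCross(P⁰)]` — the `(1 − t)` from the forced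
cells, the rest affine in `t`, with the merged cells `m⁺` of `RootEdgeRow.lean` appearing at `t = 1`.
If (3M) holds for every product law on the graph (`ThreeMark`), the affine part is `≥ 0` on
`[0, 1)` and hence at `t = 1` (`affine_nonneg_at_one`, g21's `t → 1` extraction): this is exactly
the `RootCross` slack at `P⁰`.  Finally the `RootCross` slack at an arbitrary `p` is
`(1 − p_g)` times the slack at `p[g := 0]` (`rootCross_slack_pin`: the merged cells do not depend on
`p_g`), so

  **`rootCross_of_threeMark`: `ThreeMark ends a₁ a₂ b o v → RootCross ends a₁ a₂ b o v`**

for every graph with an edge `g = {a₁, v}`.  Consequently (`RootEdgeTheorems.lean`) g20's root-edge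
row `M ≥ Φ₁₁` and the weighted rows (ROW-23-R), (ROW-MIN-R) on `a₃`-inactive instances are theorems
MODULO (3M) ALONE (`Phi11_le_M_of_threeMark`, `wrow23R_rootEdge_of_threeMark`,
`wrowMinR_rootEdge_of_threeMark`): the `b ~ v` cells and the refuted summand (F) drop out of the
candidate of record, which is now the single unmerged 5-mark statement (3M)
(0 / 427,670 exact rows + 2,806,985 adversarial evaluations, g21 §30.4–30.5).
Exact control of the pinning identity: 720 / 720 random instances (n ≤ 6, m ≤ 8, t ∈ {⅓, ½, ¾};
`mining/night-3/g22/check_forcing.py`).  Own work; standard axioms.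
-/

namespace Summit.Ventures.PercRepro2

open UnionCluster

namespace CovForm

namespace RootEdge

variable {V : Type*} {E : Type*} [Fintype E] [DecidableEq E] [DecidableEq V]
  {R : Type*} [Field R] [LinearOrder R] [IsStrictOrderedRing R]

/-! ## Pinning the cells at the root edge -/

omit [DecidableEq V] [LinearOrder R] [IsStrictOrderedRing R] in
/-- A cell pins at `g`: `m_p = p_g·m_1 + (1 − p_g)·m_0`. -/
lemma cell_pin (p : E → R) (ends : E → Sym2 V) (a₁ a₂ b o v : V) (g : E) (χ ω β : Bool) :
    cell p ends a₁ a₂ b o v χ ω β =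
      p g * cell (Function.update p g 1) ends a₁ a₂ b o v χ ω β +
        (1 - p g) * cell (Function.update p g 0) ends a₁ a₂ b o v χ ω β := by
  unfold cell
  exact prob_eq_pin p _ g

omit [DecidableEq V] [LinearOrder R] [IsStrictOrderedRing R] in
/-- A `b ~ v` cell pins at `g`. -/
lemma bvcell_pin (p : E → R) (ends : E → Sym2 V) (a₁ a₂ b o v : V) (g : E) (ω : Bool) :
    bvcell p ends a₁ a₂ b o v ω =
      p g * bvcell (Function.update p g 1) ends a₁ a₂ b o v ω +
        (1 - p g) * bvcell (Function.update p g 0) ends a₁ a₂ b o v ω := by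
  unfold bvcell
  exact prob_eq_pin p _ g

omit [DecidableEq V] [LinearOrder R] [IsStrictOrderedRing R] in
/-- A cell of `p[g := t]` pins to `t·m_1 + (1 − t)·m_0`. -/
lemma cell_update_pin (p : E → R) (ends : E → Sym2 V) (a₁ a₂ b o v : V) (g : E) (t : R)
    (χ ω β : Bool) :
    cell (Function.update p g t) ends a₁ a₂ b o v χ ω β =
      t * cell (Function.update p g 1) ends a₁ a₂ b o v χ ω β +
        (1 - t) * cell (Function.update p g 0) ends a₁ a₂ b o v χ ω β := by
  have := cell_pin (Function.update p g t) ends a₁ a₂ b o v g χ ω β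
  rwa [Function.update_idem, Function.update_idem, Function.update_self] at this

/-! ## The cells of `P¹` as `P⁰`-masses -/

omit [DecidableEq V] [LinearOrder R] [IsStrictOrderedRing R] in
/-- Under `P¹` (the root edge `g = {a₁, v}` open) every cell with `v ∈ C₂` is null: `v ∈ C₂` and
`g` open put `a₁ ∈ C₂`, contradicting `Q`. -/
lemma cell_update_one_true (p : E → R) {ends : E → Sym2 V} {g : E} {a₁ v : V}
    (hg : ends g = s(a₁, v)) (a₂ b o : V) (ω β : Bool) :
    cell (Function.update p g 1) ends a₁ a₂ b o v true ω β = 0 := by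
  unfold cell
  rw [prob_update_one_eq_prob_update_zero p g (Y := ∅) fun ω' => ?_, prob_empty]
  rw [← Function.update_idem false true ω']
  simp only [Set.mem_inter_iff, cellSet, Set.mem_setOf_eq, Set.mem_empty_iff_false, iff_false]
  rintro ⟨hQ, hv, -, -⟩
  rw [mem_Q_update_true_iff hg] at hQ
  exact hQ.2 ((conn_a₂_update_true_iff_of_Q' hg hQ.1 hQ.2 v).1 (hv.2 trivial))

omit [DecidableEq V] [LinearOrder R] [IsStrictOrderedRing R] in
/-- Under `P¹` the `b ~ v` cells are null: `g` open puts `v ∈ C₁`, so `b ↔ v` gives `b ∈ C₁`. -/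
lemma bvcell_update_one (p : E → R) {ends : E → Sym2 V} {g : E} {a₁ v : V}
    (hg : ends g = s(a₁, v)) (a₂ b o : V) (ω : Bool) :
    bvcell (Function.update p g 1) ends a₁ a₂ b o v ω = 0 := by
  unfold bvcell
  rw [prob_update_one_eq_prob_update_zero p g (Y := ∅) fun ω' => ?_, prob_empty]
  rw [← Function.update_idem false true ω']
  simp only [Set.mem_inter_iff, Set.mem_setOf_eq, Set.mem_empty_iff_false, iff_false]
  rintro ⟨-, -, hb, hvb, -⟩
  rw [conn_a₁_update_true_iff hg] at hb
  rw [OneEdge.conn_update_true_iff hg] at hvb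
  rcases hvb with h | ⟨-, h⟩ | ⟨-, h⟩
  · exact hb (Or.inr h)
  · exact hb (Or.inr h)
  · exact hb (Or.inl h)

omit [DecidableEq V] [LinearOrder R] [IsStrictOrderedRing R] in
/-- Under `P¹`, `m(0, ω, 1) = m⁰(0, ω, 1) + bvcell⁰(ω)`: on `Q′` opening `g` keeps `C(a₂)` and
merges `C(v)` into `C(a₁)`, so `b ∈ C₁` after opening is `b ∈ C₁` or `b ~ v` before. -/
lemma cell_update_one_false_true (p : E → R) {ends : E → Sym2 V} {g : E} {a₁ v : V}
    (hg : ends g = s(a₁, v)) (a₂ b o : V) (ω : Bool) :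
    cell (Function.update p g 1) ends a₁ a₂ b o v false ω true =
      cell (Function.update p g 0) ends a₁ a₂ b o v false ω true +
        bvcell (Function.update p g 0) ends a₁ a₂ b o v ω := by
  unfold cell bvcell
  rw [← prob_union_of_disjoint]
  · apply prob_update_one_eq_prob_update_zero
    intro ω'
    rw [← Function.update_idem false true ω']
    simp only [Set.mem_inter_iff, Set.mem_union, cellSet, Set.mem_setOf_eq, Bool.false_eq_true,
      iff_false, iff_true]
    constructor
    · rintro ⟨hQ', hv', ho', hb'⟩
      rw [mem_Q_update_true_iff hg] at hQ'
      obtain ⟨hQ, hv⟩ := hQ'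
      rw [conn_a₂_update_true_iff_of_Q' hg hQ hv] at ho'
      rw [conn_a₁_update_true_iff hg] at hb'
      by_cases hb1 : Conn ends (Function.update ω' g false) a₁ b
      · exact Or.inl ⟨hQ, hv, ho', hb1⟩
      · exact Or.inr ⟨hQ, hv, hb1, hb'.resolve_left hb1, ho'⟩
    · rintro (⟨hQ, hv, ho, hb⟩ | ⟨hQ, hv, hb, hvb, ho⟩)
      · refine ⟨(mem_Q_update_true_iff hg _ a₂).2 ⟨hQ, hv⟩, ?_, ?_, ?_⟩
        · rw [conn_a₂_update_true_iff_of_Q' hg hQ hv]; exact hv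
        · rw [conn_a₂_update_true_iff_of_Q' hg hQ hv]; exact ho
        · rw [conn_a₁_update_true_iff hg]; exact Or.inl hb
      · refine ⟨(mem_Q_update_true_iff hg _ a₂).2 ⟨hQ, hv⟩, ?_, ?_, ?_⟩
        · rw [conn_a₂_update_true_iff_of_Q' hg hQ hv]; exact hv
        · rw [conn_a₂_update_true_iff_of_Q' hg hQ hv]; exact ho
        · rw [conn_a₁_update_true_iff hg]; exact Or.inr hvb
  · rw [Set.disjoint_left]
    rintro ω' ⟨-, -, -, hb⟩ ⟨-, -, hb', -, -⟩
    exact hb' (hb.2 rfl)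

omit [DecidableEq V] [LinearOrder R] [IsStrictOrderedRing R] in
/-- Under `P¹`, `m(0, ω, 0) = m⁰(0, ω, 0) − bvcell⁰(ω)`: `b ∉ C₁` after opening `g` is
`b ∉ C₁ ∪ C(v)` before, i.e. `b ∉ C₁` minus the `b ~ v` cell. -/
lemma cell_update_one_false_false (p : E → R) {ends : E → Sym2 V} {g : E} {a₁ v : V}
    (hg : ends g = s(a₁, v)) (a₂ b o : V) (ω : Bool) :
    cell (Function.update p g 1) ends a₁ a₂ b o v false ω false =
      cell (Function.update p g 0) ends a₁ a₂ b o v false ω false -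
        bvcell (Function.update p g 0) ends a₁ a₂ b o v ω := by
  -- the `P⁰`-mass of `{Q, v ∉ C₂, [o ∈ C₂] = ω, b ∉ C₁, b ↮ v}`
  set Y : Set (Config E) := {ω' | ω' ∈ avoidAll ends a₂ {a₁} ∧ ¬ Conn ends ω' a₂ v ∧
    (Conn ends ω' a₂ o ↔ ω = true) ∧ ¬ Conn ends ω' a₁ b ∧ ¬ Conn ends ω' v b} with hY
  have h1 : cell (Function.update p g 1) ends a₁ a₂ b o v false ω false =
      prob (Function.update p g 0) Y := by
    unfold cell
    apply prob_update_one_eq_prob_update_zero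
    intro ω'
    rw [← Function.update_idem false true ω']
    simp only [Set.mem_inter_iff, cellSet, Set.mem_setOf_eq, Bool.false_eq_true, iff_false, hY]
    constructor
    · rintro ⟨hQ', hv', ho', hb'⟩
      rw [mem_Q_update_true_iff hg] at hQ'
      obtain ⟨hQ, hv⟩ := hQ'
      rw [conn_a₂_update_true_iff_of_Q' hg hQ hv] at ho'
      rw [conn_a₁_update_true_iff hg] at hb'
      exact ⟨hQ, hv, ho', fun h => hb' (Or.inl h), fun h => hb' (Or.inr h)⟩
    · rintro ⟨hQ, hv, ho, hb, hvb⟩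
      refine ⟨(mem_Q_update_true_iff hg _ a₂).2 ⟨hQ, hv⟩, ?_, ?_, ?_⟩
      · rw [conn_a₂_update_true_iff_of_Q' hg hQ hv]; exact hv
      · rw [conn_a₂_update_true_iff_of_Q' hg hQ hv]; exact ho
      · rw [conn_a₁_update_true_iff hg]
        rintro (h | h)
        · exact hb h
        · exact hvb h
  have h2 : cell (Function.update p g 0) ends a₁ a₂ b o v false ω false =
      prob (Function.update p g 0) Y + bvcell (Function.update p g 0) ends a₁ a₂ b o v ω := by
    unfold cell bvcell
    rw [← prob_union_of_disjoint]
    · congr 1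
      ext ω'
      simp only [Set.mem_inter_iff, Set.mem_union, cellSet, Set.mem_setOf_eq, Bool.false_eq_true,
        iff_false, hY]
      constructor
      · rintro ⟨hQ, hv, ho, hb⟩
        by_cases hvb : Conn ends ω' v b
        · exact Or.inr ⟨hQ, hv, hb, hvb, ho⟩
        · exact Or.inl ⟨hQ, hv, ho, hb, hvb⟩
      · rintro (⟨hQ, hv, ho, hb, -⟩ | ⟨hQ, hv, hb, -, ho⟩)
        · exact ⟨hQ, hv, ho, hb⟩
        · exact ⟨hQ, hv, ho, hb⟩
    · rw [Set.disjoint_left]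
      rintro ω' ⟨-, -, -, -, hvb⟩ ⟨-, -, -, hvb', -⟩
      exact hvb hvb'
  rw [h1, h2]
  ring

/-! ## The forcing: (3M) at every `p[g := t]` gives `RootCross` at `p[g := 0]` -/

omit [DecidableEq V] in
/-- **The `RootCross` slack at `p[g := 0]` is forced by (3M)**: with the cells `m = m_0` and the
`b ~ v` cells `bv = bvcell_0` of `P⁰`,
`m(011)·m(100) + m(111)·m(000) ≤ m(101)·m(010) + m(001)·m(110)` at every `p[g := t]` gives
`(m(011) + bv₁)·m(100) + m(111)·(m(000) − bv₀) ≤ m(101)·(m(010) − bv₁) + (m(001) + bv₀)·m(110)`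
— the (3M)-slack of `p[g := t]` is `(1 − t)·(affine in t)` whose value at `t = 1` is the
`RootCross` slack. -/
theorem rootCross_slack_update_zero_of_threeMark (ends : E → Sym2 V) (o a₁ a₂ b v : V) {g : E}
    (hg : ends g = s(a₁, v)) (h3 : ThreeMark (R := R) ends a₁ a₂ b o v)
    (p : E → R) (hp : IsProbVec p) :
    (cell (Function.update p g 0) ends a₁ a₂ b o v false true true +
          bvcell (Function.update p g 0) ends a₁ a₂ b o v true) *
          cell (Function.update p g 0) ends a₁ a₂ b o v true false false +
        cell (Function.update p g 0) ends a₁ a₂ b o v true true true *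
          (cell (Function.update p g 0) ends a₁ a₂ b o v false false false -
            bvcell (Function.update p g 0) ends a₁ a₂ b o v false) ≤
      cell (Function.update p g 0) ends a₁ a₂ b o v true false true *
          (cell (Function.update p g 0) ends a₁ a₂ b o v false true false -
            bvcell (Function.update p g 0) ends a₁ a₂ b o v true) +
        (cell (Function.update p g 0) ends a₁ a₂ b o v false false true +
            bvcell (Function.update p g 0) ends a₁ a₂ b o v false) *
          cell (Function.update p g 0) ends a₁ a₂ b o v true true false := by
  -- the `P⁰` masses
  set c000 := cell (Function.update p g 0) ends a₁ a₂ b o v false false false with hc000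
  set c001 := cell (Function.update p g 0) ends a₁ a₂ b o v false false true with hc001
  set c010 := cell (Function.update p g 0) ends a₁ a₂ b o v false true false with hc010
  set c011 := cell (Function.update p g 0) ends a₁ a₂ b o v false true true with hc011
  set c100 := cell (Function.update p g 0) ends a₁ a₂ b o v true false false with hc100
  set c101 := cell (Function.update p g 0) ends a₁ a₂ b o v true false true with hc101
  set c110 := cell (Function.update p g 0) ends a₁ a₂ b o v true true false with hc110
  set c111 := cell (Function.update p g 0) ends a₁ a₂ b o v true true true with hc111
  set bv0 := bvcell (Function.update p g 0) ends a₁ a₂ b o v false with hbv0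
  set bv1 := bvcell (Function.update p g 0) ends a₁ a₂ b o v true with hbv1
  -- the (3M)-slack of `P⁰` and the `RootCross` slack of `P⁰`
  set α : R := c101 * c010 + c001 * c110 - c011 * c100 - c111 * c000 with hα
  set γ : R := c101 * (c010 - bv1) + (c001 + bv0) * c110 - (c011 + bv1) * c100 -
    c111 * (c000 - bv0) with hγ
  -- (3M) at `p[g := t]`, pinned: `(1 − t)·(α + t·(γ − α)) ≥ 0`
  have hall : ∀ t : R, 0 ≤ t → t ≤ 1 → 0 ≤ (1 - t) * (α + t * (γ - α)) := by
    intro t ht0 ht1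
    have hpt : IsProbVec (Function.update p g t) := hp.update g ht0 ht1
    have h := h3 (Function.update p g t) hpt
    simp only [cell_update_pin p ends a₁ a₂ b o v g t, cell_update_one_true p hg,
      cell_update_one_false_true p hg, cell_update_one_false_false p hg] at h
    have hid : (1 - t) * (α + t * (γ - α)) =
        (t * 0 + (1 - t) * c101) * (t * (c010 - bv1) + (1 - t) * c010) +
            (t * (c001 + bv0) + (1 - t) * c001) * (t * 0 + (1 - t) * c110) -
          ((t * (c011 + bv1) + (1 - t) * c011) * (t * 0 + (1 - t) * c100) +
            (t * 0 + (1 - t) * c111) * (t * (c000 - bv0) + (1 - t) * c000)) := by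
      rw [hα, hγ]; ring
    rw [hid]
    linarith [h]
  -- divide by `(1 − t)` on `[0, 1)` and let `t → 1`
  have haff : ∀ t : R, 0 ≤ t → t < 1 → 0 ≤ α + t * (γ - α) := by
    intro t ht0 ht1
    have hpos : 0 < 1 - t := by linarith
    exact (mul_nonneg_iff_of_pos_left hpos).1 (hall t ht0 ht1.le)
  have hγ0 : 0 ≤ α + (γ - α) := affine_nonneg_at_one haff
  have : 0 ≤ γ := by linarith [hγ0]
  rw [hγ] at this
  linarith [this]

omit [DecidableEq V] [LinearOrder R] [IsStrictOrderedRing R] in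
/-- **The `RootCross` slack pins to `(1 − p_g)` times the slack at `p[g := 0]`**: the merged cells
`m⁺` do not depend on `p_g` (they are `P¹`-masses and `P⁰`-masses alike), the unmerged ones carry
the forced factor `(1 − p_g)`. -/
lemma rootCross_slack_pin (p : E → R) {ends : E → Sym2 V} {g : E} {a₁ v : V}
    (hg : ends g = s(a₁, v)) (a₂ b o : V) :
    cell p ends a₁ a₂ b o v true false true *
          (cell p ends a₁ a₂ b o v false true false - bvcell p ends a₁ a₂ b o v true) +
        (cell p ends a₁ a₂ b o v false false true + bvcell p ends a₁ a₂ b o v false) *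
          cell p ends a₁ a₂ b o v true true false -
      ((cell p ends a₁ a₂ b o v false true true + bvcell p ends a₁ a₂ b o v true) *
          cell p ends a₁ a₂ b o v true false false +
        cell p ends a₁ a₂ b o v true true true *
          (cell p ends a₁ a₂ b o v false false false - bvcell p ends a₁ a₂ b o v false)) =
      (1 - p g) *
        (cell (Function.update p g 0) ends a₁ a₂ b o v true false true *
            (cell (Function.update p g 0) ends a₁ a₂ b o v false true false -
              bvcell (Function.update p g 0) ends a₁ a₂ b o v true) +
          (cell (Function.update p g 0) ends a₁ a₂ b o v false false true +
              bvcell (Function.update p g 0) ends a₁ a₂ b o v false) *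
            cell (Function.update p g 0) ends a₁ a₂ b o v true true false -
        ((cell (Function.update p g 0) ends a₁ a₂ b o v false true true +
              bvcell (Function.update p g 0) ends a₁ a₂ b o v true) *
            cell (Function.update p g 0) ends a₁ a₂ b o v true false false +
          cell (Function.update p g 0) ends a₁ a₂ b o v true true true *
            (cell (Function.update p g 0) ends a₁ a₂ b o v false false false -
              bvcell (Function.update p g 0) ends a₁ a₂ b o v false))) := by
  simp only [cell_pin p ends a₁ a₂ b o v g, bvcell_pin p ends a₁ a₂ b o v g,
    cell_update_one_true p hg, cell_update_one_false_true p hg, cell_update_one_false_false p hg,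
    bvcell_update_one p hg]
  ring

omit [DecidableEq V] in
/-- **`RootCross` is forced by (3M)**: on every graph with an edge `g = {a₁, v}`,
`ThreeMark ends a₁ a₂ b o v → RootCross ends a₁ a₂ b o v` — the candidate of record of g21 (§30.2)
reduces to the unmerged 5-mark inequality (3M) on the same graph, by the `t → 1` extraction at `g`
(`rootCross_slack_update_zero_of_threeMark`) and the pinning of the slack
(`rootCross_slack_pin`). -/
theorem rootCross_of_threeMark (ends : E → Sym2 V) (o a₁ a₂ b v : V) {g : E}
    (hg : ends g = s(a₁, v)) (h3 : ThreeMark (R := R) ends a₁ a₂ b o v) :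
    RootCross (R := R) ends a₁ a₂ b o v := by
  intro p hp
  have h0 := rootCross_slack_update_zero_of_threeMark ends o a₁ a₂ b v hg h3 p hp
  have hpin := rootCross_slack_pin p hg a₂ b o
  have hq : 0 ≤ 1 - p g := sub_nonneg.2 (hp.le_one g)
  have key := mul_nonneg hq (sub_nonneg.2 h0)
  linarith [key, hpin]

/-! ## The root-edge rows modulo (3M) alone -/

omit [DecidableEq V] in
/-- **g20's root-edge row `M ≥ Φ₁₁` ⟸ (3M) in both orientations** (`Phi11_le_M_of_rootCross` with
`RootCross` discharged by `rootCross_of_threeMark`). -/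
theorem Phi11_le_M_of_threeMark [Fintype V] (ends : E → Sym2 V) (o a₁ a₂ b v : V) {g : E}
    (hg : ends g = s(a₁, v))
    (h3 : ThreeMark (R := R) ends a₁ a₂ b o v) (h3' : ThreeMark (R := R) ends a₁ a₂ o b v)
    (p : E → R) (hp : IsProbVec p) :
    (prob (Function.update p g 1) (avoidAll ends a₂ {a₁} ∩ connEvent ends a₁ b) *
          prob (Function.update p g 1) (avoidAll ends a₂ {a₁} ∩ connEvent ends a₂ o) -
        prob (Function.update p g 1) (avoidAll ends a₂ {a₁}) *
          prob (Function.update p g 1)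
            (avoidAll ends a₂ {a₁} ∩ (connEvent ends a₂ o ∩ connEvent ends a₁ b))) +
      (prob (Function.update p g 1) (avoidAll ends a₂ {a₁} ∩ connEvent ends a₂ b) *
          prob (Function.update p g 1) (avoidAll ends a₂ {a₁} ∩ connEvent ends a₁ o) -
        prob (Function.update p g 1) (avoidAll ends a₂ {a₁}) *
          prob (Function.update p g 1)
            (avoidAll ends a₂ {a₁} ∩ (connEvent ends a₁ o ∩ connEvent ends a₂ b))) ≤
    (prob (Function.update p g 0) (avoidAll ends a₂ {a₁} ∩ connEvent ends a₁ b) *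
          prob (Function.update p g 1) (avoidAll ends a₂ {a₁} ∩ connEvent ends a₂ o) +
        prob (Function.update p g 1) (avoidAll ends a₂ {a₁} ∩ connEvent ends a₁ b) *
          prob (Function.update p g 0) (avoidAll ends a₂ {a₁} ∩ connEvent ends a₂ o) +
        prob (Function.update p g 0) (avoidAll ends a₂ {a₁} ∩ connEvent ends a₂ b) *
          prob (Function.update p g 1) (avoidAll ends a₂ {a₁} ∩ connEvent ends a₁ o) +
        prob (Function.update p g 1) (avoidAll ends a₂ {a₁} ∩ connEvent ends a₂ b) *
          prob (Function.update p g 0) (avoidAll ends a₂ {a₁} ∩ connEvent ends a₁ o)) -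
      (prob (Function.update p g 0) (avoidAll ends a₂ {a₁}) *
          prob (Function.update p g 1)
            (avoidAll ends a₂ {a₁} ∩ (connEvent ends a₂ o ∩ connEvent ends a₁ b)) +
        prob (Function.update p g 1) (avoidAll ends a₂ {a₁}) *
          prob (Function.update p g 0)
            (avoidAll ends a₂ {a₁} ∩ (connEvent ends a₂ o ∩ connEvent ends a₁ b)) +
        prob (Function.update p g 0) (avoidAll ends a₂ {a₁}) *
          prob (Function.update p g 1)
            (avoidAll ends a₂ {a₁} ∩ (connEvent ends a₁ o ∩ connEvent ends a₂ b)) +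
        prob (Function.update p g 1) (avoidAll ends a₂ {a₁}) *
          prob (Function.update p g 0)
            (avoidAll ends a₂ {a₁} ∩ (connEvent ends a₁ o ∩ connEvent ends a₂ b))) :=
  Phi11_le_M_of_rootCross ends o a₁ a₂ b v hg (rootCross_of_threeMark ends o a₁ a₂ b v hg h3)
    (rootCross_of_threeMark ends b a₁ a₂ o v hg h3') p hp

/-- **The weighted (ROW-23-R) at a root edge of an `a₃`-inactive instance ⟸ (3M)**:
`2 p_g² (1 − p_g) · Gc(p[g := 1]) ≤ T₂(p)` (g21's `wrow23R_rootEdge_of_a3Inactive` with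
`RootCross` discharged by `rootCross_of_threeMark`). -/
theorem wrow23R_rootEdge_of_threeMark [Fintype V] (ends : E → Sym2 V) (o a₁ a₂ a₃ b v : V)
    {g : E} (hg : ends g = s(a₁, v))
    (h3 : ThreeMark (R := R) ends a₁ a₂ b o v) (h3' : ThreeMark (R := R) ends a₁ a₂ o b v)
    (hinact : ∀ ω : Config E, ¬ Conn ends ω a₁ a₃ ∧ ¬ Conn ends ω a₂ a₃)
    (p : E → R) (hp : IsProbVec p) (τ : E → ℕ) (hτ : τ g = 2) :
    2 * (p g ^ 2 * (1 - p g)) * Gc (Function.update p g 1) ends o a₁ a₂ a₃ b ≤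
      triSum p {g} τ (K3 ends o a₁ a₂ a₃ b) :=
  wrow23R_rootEdge_of_a3Inactive ends o a₁ a₂ a₃ b v hg
    (rootCross_of_threeMark ends o a₁ a₂ b v hg h3)
    (rootCross_of_threeMark ends b a₁ a₂ o v hg h3') hinact p hp τ hτ

/-- **The weighted (ROW-MIN-R) at a root edge of an `a₃`-inactive instance ⟸ (3M)**:
`p_g (1 − p_g)² · Gc(p[g := 1]) ≤ T₁(p)` (g21's `wrowMinR_rootEdge_of_a3Inactive` with
`RootCross` discharged by `rootCross_of_threeMark`). -/
theorem wrowMinR_rootEdge_of_threeMark [Fintype V] (ends : E → Sym2 V) (o a₁ a₂ a₃ b v : V)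
    {g : E} (hg : ends g = s(a₁, v))
    (h3 : ThreeMark (R := R) ends a₁ a₂ b o v) (h3' : ThreeMark (R := R) ends a₁ a₂ o b v)
    (hinact : ∀ ω : Config E, ¬ Conn ends ω a₁ a₃ ∧ ¬ Conn ends ω a₂ a₃)
    (p : E → R) (hp : IsProbVec p) (τ : E → ℕ) (hτ : τ g = 1) :
    p g * (1 - p g) ^ 2 * Gc (Function.update p g 1) ends o a₁ a₂ a₃ b ≤
      triSum p {g} τ (K3 ends o a₁ a₂ a₃ b) :=
  wrowMinR_rootEdge_of_a3Inactive ends o a₁ a₂ a₃ b v hg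
    (rootCross_of_threeMark ends o a₁ a₂ b v hg h3)
    (rootCross_of_threeMark ends b a₁ a₂ o v hg h3') hinact p hp τ hτ

end RootEdge

end CovForm

end Summit.Ventures.PercRepro2
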